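import Literature.AlgebraicGeometry.AbelianVarieties.MarkmanKernelTranslate
import Literature.AlgebraicGeometry.AbelianVarieties.IsogenyNormDescent
import Literature.AlgebraicGeometry.Motives.AbelianVarietyTorsionQuotient
import HarnessLib

/-!
# Descent of Markman's twisted span kernel along `(A × A) × Â → (A/G₁ × A/G₂) × Â`:
# `π′^*𝒩₀ ≅ 𝒩 ⊗ g′^*D′_s` with `D′_s`, `𝒩₀` EXPLICIT

Layer `Literature/AlgebraicGeometry/AbelianVarieties`; sequel to `MarkmanKernelTranslate` (the twisted kernel `𝒩` of
Markman's `Φ̃` on `Z = (A × A) × Â`, the span leg `g′ = (a b⁻¹, β·φ_Θ(ab))`, and the class calculus `λ`, `Λ` along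
`T`-valued points) and to `IsogenyNormDescent` (`π^*[isogenyNorm π F] = [F]^{|Ker π|}` for `|Ker π|` odd). For finite
subgroups `G₁, G₂ ≤ A[n](ℂ)` of order `n = 2j + 1` with quotients `πᵢ : A → Aᵢ = A/Gᵢ`:

* §1 `[n]_A = πᵢ ≫ rᵢ` (`zsmulFactor`), the kernel count `|Ker πᵢ(ℂ)| = |Gᵢ|`;
* §2 the bundles: `Θ_sym := 𝒪(Θ) ⊗ [−1]^*𝒪(Θ)` on `A`, `Θ̂ := (φ_Θ⁻¹)^*𝒪(Θ)` and `Θ̂^{⊗s} ⊗ [−1]^*Θ̂^{⊗(s+1)}` on `Â`,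
  the TWIST **`D′_s := pr_A^*Θ_sym^{⊗s} ⊗ 𝒫^{⊗j} ⊗ pr_Â^*(Θ̂^{⊗s} ⊗ [−1]^*Θ̂^{⊗(s+1)})`** on `A × Â` (`descentTwist`; Néron–Severi
  type `(2s, j, 2s+1) ≡ (j, j, j+1) mod n` when `n ∣ 4s+1`), and their classes along `T`-valued points;
* §3 the quotient span source `Z₀ = (A₁ × A₂) × Â`, `π′ = (π₁ × π₂) × 1_Â` (`quotientSpanProjection`), `κᵢ = (rᵢ ∘ prᵢ, pr_Â)`,
  and the DESCENDED KERNEL **`𝒩₀ := pr₁^*N₁^{⊗m₁} ⊗ pr₂^*N₂^{⊗m₂} ⊗ pr_Â^*(Θ̂^{⊗s} ⊗ [−1]^*Θ̂^{⊗(s+1)}) ⊗ κ₁^*𝒫^{⊗m₁} ⊗ κ₂^*𝒫^{⊗m₂}`**,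
  `Nᵢ = isogenyNorm πᵢ Θ_sym` (`markmanDescendedKernel`);
* the class identity `π′^*[𝒩₀] = [𝒩] · g′^*[D′_s]` and the descent isomorphism `π′^*𝒩₀ ≅ 𝒩 ⊗ g′^*D′_s` are the sequel
  `MarkmanKernelDescentIdentity`.

This is the kernel-descent step of the cell `pub-hodge-ring2`'s reading of Markman §9.3 (Lemma 9.3.3/9.3.5, Remark 9.3.7: the
`Ḡ`-equivariant kernel descends to the quotient): print descends `𝒢 ⊗ D^a` by a linearisation; here the twisted KERNEL of `Φ̃`
descends along the product isogeny, in class currency, with no linearisation and no cocycle — the `[−1]^*` factors of `D′_s`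
absorb the asymmetry class `[Θ] − [−1]^*[Θ] ∈ Pic⁰` of a non-symmetric `Θ`. Cyclicity of `Gᵢ` and `G₁ ∩ G₂ = 0` are NOT
used here. Everything PROVED; 0 named facts; no instance, no notation. A research route conditional on HC_CM, not a corollary
— nothing here refers to it.

## References

* E. Markman, arXiv:2502.03415 (2025), §9.3 Lemma 9.3.3, Lemma 9.3.5, Remark 9.3.7 (pp. 71–73). [Markman2025SecantWeil]
* D. Mumford, *Abelian Varieties* (1970), §6 Cor. 3–4, §7 Thm. 4 (p. 72), §8, §23. [MumfordAV1970]
* J. S. Milne, *Abelian Varieties* (2008), I §8 Rem. 8.6, 8.12. [MilneAV2008]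
* H. Lange, *Abelian Varieties over the Complex Numbers* (2023), Lemma 6.1.3. [Lange2023AbelianVarietiesComplex]
* R. Hartshorne, *Algebraic Geometry* (1977), II Ex. 6.8, III Ex. 4.5. [Hartshorne1977]
-/

noncomputable section

-- `TopCat.Presheaf`/`Scheme.Modules` are not reducible (as in Mathlib's `AlgebraicGeometry/Modules/Sheaf.lean`).
set_option backward.isDefEq.respectTransparency false

open CategoryTheory CategoryTheory.Limits AlgebraicGeometry MonoidalCategory CartesianMonoidalCategory
open AlgebraicGeometry.Scheme.Modules

/-! ### §1 Quotients by finite subgroups: `[n] = π ≫ r` and `|Ker π(ℂ)| = |G|` -/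

namespace Literature.AlgebraicGeometry.Motives.AbelianVariety

open scoped MonObj

variable (A : AbelianVariety ℂ) {n : ℕ} (hn : n ≠ 0) (S : Subgroup (A.Points ℂ)) (hS : S ≤ A.torsionPoints ℂ n)

/-- **A factorisation `[n]_A = π ≫ r` through the quotient `π : A → A/S`, `S ≤ A[n](ℂ)`** (a CHOSEN `r`;
`exists_torsionQuotHom_comp_eq_zsmul_id`). [cite: MilneAV2008, I §8 Rem. 8.6 and Rem. 8.12 (pp. 36–39)] -/
def zsmulFactor : A.torsionQuot hn S hS ⟶ A :=
  (A.exists_torsionQuotHom_comp_eq_zsmul_id hn S hS).choose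

/-- `π ≫ r = [n]_A`. [cite: MilneAV2008, I §8 Rem. 8.6 and Rem. 8.12 (pp. 36–39)] -/
theorem torsionQuotHom_comp_zsmulFactor : A.torsionQuotHom hn S hS ≫ A.zsmulFactor hn S hS = (n : ℤ) • 𝟙 A :=
  (A.exists_torsionQuotHom_comp_eq_zsmul_id hn S hS).choose_spec

/-- `Ker π(ℂ)` is finite (it is `S ≤ A[n](ℂ)`). [cite: MumfordAV1970, §7 Thm. 4 p. 72] -/
theorem finite_kerPoints_torsionQuotHom : Finite ↥(Hom.kerPoints (specOver ℂ ℂ) (A.torsionQuotHom hn S hS)) := by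
  rw [A.kerPoints_torsionQuotHom_eq hn S hS]
  exact A.finite_of_le_torsionPoints hn hS

/-- A `Fintype` structure on `Ker π(ℂ)` (for the `Fintype`-indexed statements of `IsogenyNormDescent`). [cite: MumfordAV1970, §7 Thm. 4 p. 72] -/
@[reducible] def kerPointsTorsionQuotHomFintype : Fintype ↥(Hom.kerPoints (specOver ℂ ℂ) (A.torsionQuotHom hn S hS)) :=
  @Fintype.ofFinite _ (A.finite_kerPoints_torsionQuotHom hn S hS)

/-- **`|Ker π(ℂ)| = |S|`.** [cite: MumfordAV1970, §7 Thm. 4 p. 72] -/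
theorem card_kerPoints_torsionQuotHom [Fintype ↥(Hom.kerPoints (specOver ℂ ℂ) (A.torsionQuotHom hn S hS))] :
    Fintype.card ↥(Hom.kerPoints (specOver ℂ ℂ) (A.torsionQuotHom hn S hS)) = Nat.card S := by
  rw [Fintype.card_eq_nat_card, A.kerPoints_torsionQuotHom_eq hn S hS]

/-- `x ≫ π ≫ r = xⁿ` for a `T`-valued point `x` of `A`. [cite: MilneAV2008, I §8 Rem. 8.6 (p. 36)] -/
theorem comp_torsionQuotHom_comp_zsmulFactor {T : SchemeOver ℂ} (x : T ⟶ A.X) :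
    x ≫ (A.torsionQuotHom hn S hS).hom.hom.hom ≫ (A.zsmulFactor hn S hS).hom.hom.hom = x ^ n := by
  have h : (A.torsionQuotHom hn S hS).hom.hom.hom ≫ (A.zsmulFactor hn S hS).hom.hom.hom = (((n : ℤ) • 𝟙 A : A ⟶ A)).hom.hom.hom := by
    rw [← A.torsionQuotHom_comp_zsmulFactor hn S hS]
    rfl
  rw [h, AbelianVariety.hom_zsmul_id, GrpObj.comp_zpow, Category.comp_id, zpow_natCast]

end Literature.AlgebraicGeometry.Motives.AbelianVariety

namespace Literature.AlgebraicGeometry.AbelianVarieties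

open Literature.AlgebraicGeometry.Motives Literature.AlgebraicGeometry.Modules
open scoped MonObj

variable (A : AbelianVariety ℂ) {Θ : CartierDivisor A.X.left} (hΘ : Θ.IsAmple)

/-! ### §2 The bundles `Θ_sym`, `Θ̂`, `D′_s` and their classes along `T`-valued points -/

section Bundles

variable {T : SchemeOver ℂ} [IsIntegral T.left]

omit [IsIntegral T.left] in
/-- `(f ≫ g)^* = f^* ∘ g^*` on `Ȟ¹(–, 𝒪^×)` (the tree's `CechPic.pullback_comp` of `Modules/UnitCocyclePresented`, outside this
file's imports; re-proved privately as in `PoincareSheafOfPrincipal`). [cite: Hartshorne1977, II Ex. 6.8 (functoriality of f^* on Pic)] -/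
private theorem cechPic_pullback_comp₃ {X Y Z : Scheme.{0}} (f : X ⟶ Y) (g : Y ⟶ Z) (c : CechPic Z) :
    CechPic.pullback (f ≫ g) c = CechPic.pullback f (CechPic.pullback g c) := by
  obtain ⟨c, rfl⟩ := CechPic.mk_surjective c
  rw [CechPic.pullback_mk, CechPic.pullback_mk, CechPic.pullback_mk]
  refine CechPic.sound (UnitCocycle.equiv_of_eq _ _
    (fun x => f ⁻¹ᵁ (g ⁻¹ᵁ c.U (g.base (f.base x)))) (fun x => c.mem (g.base (f.base x)))
    (fun x => le_of_eq rfl) (fun x => le_rfl) fun x y V hx hy => ?_)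
  change (g.appLE _ _ _ ≫ f.appLE _ V _) (c.g _ _ _ _ _) = (f ≫ g).appLE _ V _ (c.g _ _ _ _ _)
  rw [Scheme.Hom.appLE_comp_appLE]
  rfl

omit [IsIntegral T.left] in
/-- `x ≫ [−1]_X = x⁻¹` for a `T`-valued point `x` of an abelian variety `X`. [cite: MumfordAV1970, §4 (p. 44)] -/
private theorem comp_neg_one_hom (X : AbelianVariety ℂ) (x : T ⟶ X.X) : x ≫ (-𝟙 X).hom.hom.hom = x⁻¹ := by
  rw [show (-𝟙 X).hom.hom.hom = X.zsmulPt (-1) by rw [AbelianVariety.zsmulPt, neg_one_zsmul],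
    AbelianVariety.zsmulPt_neg_one_eq_inv, GrpObj.comp_inv, Category.comp_id]

/-- **`Λ(x, x) = λ(x) + λ(x⁻¹)`** — Mumford's `[2]^*L ≅ L^3 ⊗ [−1]^*L` read through the biadditive pairing (`Λ(x, x⁻¹) = −Λ(x, x)`
and `λ(1) = 0`). [cite: MumfordAV1970, §6 Corollary 3 (p. 59)] -/
theorem Lam_self (x : T ⟶ A.X) :
    AbelianVariety.Lam Θ (cechCl T.left) x x = AbelianVariety.lam Θ (cechCl T.left) x + AbelianVariety.lam Θ (cechCl T.left) x⁻¹ := by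
  have h := Lam_inv_right A (Θ := Θ) x x
  unfold AbelianVariety.Lam at h ⊢
  rw [mul_inv_cancel, AbelianVariety.lam_one (linEquiv_iff_cechCl_eq T.left) (cechCl_add T.left)] at h
  rw [← sub_eq_zero, ← sub_eq_zero.mpr h]
  abel

/-- `Λ(x⁻¹, y) = −Λ(x, y)`. [cite: MumfordAV1970, §6 Corollary 4 (p. 59)] -/
theorem Lam_inv_left (x y : T ⟶ A.X) :
    AbelianVariety.Lam Θ (cechCl T.left) x⁻¹ y = -AbelianVariety.Lam Θ (cechCl T.left) x y := by
  rw [AbelianVariety.Lam_comm, Lam_inv_right, AbelianVariety.Lam_comm]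

variable (Θ) in
/-- **`Θ_sym := 𝒪(Θ) ⊗ [−1]^*𝒪(Θ)`** on `A` (a symmetric line bundle of Néron–Severi type `2Θ`). [cite: MumfordAV1970, §6 Corollary 3 (p. 59)] -/
def symTheta : A.X.left.Modules :=
  tensorObj (lineBundle Θ.toUnitCocycle) ((Scheme.Modules.pullback (-𝟙 A).hom.hom.hom.left).obj (lineBundle Θ.toUnitCocycle))

/-- `Θ_sym` is finite locally free. [cite: StacksProject, Tag 01CA] -/
theorem isFiniteLocallyFree_symTheta : IsFiniteLocallyFree (symTheta A Θ) :=
  isFiniteLocallyFree_tensorObj _ _ Θ.toUnitCocycle.isFiniteLocallyFree_lineBundle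
    (Θ.toUnitCocycle.isFiniteLocallyFree_lineBundle.pullback _)

/-- `Θ_sym` has rank one. [cite: StacksProject, Tag 01CA] -/
theorem hasRank_symTheta : HasRank (symTheta A Θ) 1 :=
  hasRank_tensorObj_one Θ.toUnitCocycle.hasRank_lineBundle (hasRank_pullback _ Θ.toUnitCocycle.hasRank_lineBundle)

/-- **`ofMul (x^*[Θ_sym]) = λ(x) + λ(x⁻¹)`.** [cite: MumfordAV1970, §6 Corollary 3 (p. 59)] -/
theorem ofMul_pullback_detClass_symTheta (x : T ⟶ A.X) :
    Additive.ofMul (CechPic.pullback x.left (detClass (isFiniteLocallyFree_symTheta A (Θ := Θ)))) =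
      AbelianVariety.lam Θ (cechCl T.left) x + AbelianVariety.lam Θ (cechCl T.left) x⁻¹ := by
  have hΘ₁ := Θ.toUnitCocycle.isFiniteLocallyFree_lineBundle
  have hΘr := Θ.toUnitCocycle.hasRank_lineBundle
  rw [detClass_tensorObj_of_hasRank_one hΘr (hasRank_pullback _ hΘr) hΘ₁ (hΘ₁.pullback _) (isFiniteLocallyFree_symTheta A (Θ := Θ)),
    MonoidHom.map_mul, ofMul_mul, detClass_pullback _ hΘ₁, detClass_lineBundle_toUnitCocycle, ← cechPic_pullback_comp₃,
    ofMul_pullback_cechClass, ← Over.comp_left, ofMul_pullback_cechClass, comp_neg_one_hom]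

/-- **`ofMul (x^*[Θ_sym^{⊗m}]) = m • (λ(x) + λ(x⁻¹))`.** [cite: MumfordAV1970, §6 Corollary 3 (p. 59)] -/
theorem ofMul_pullback_detClass_tensorPow_symTheta (x : T ⟶ A.X) (m : ℕ) :
    Additive.ofMul (CechPic.pullback x.left (detClass (isFiniteLocallyFree_tensorPow (isFiniteLocallyFree_symTheta A (Θ := Θ)) m))) =
      m • (AbelianVariety.lam Θ (cechCl T.left) x + AbelianVariety.lam Θ (cechCl T.left) x⁻¹) := by
  rw [detClass_tensorPow (hasRank_symTheta A (Θ := Θ)) (isFiniteLocallyFree_symTheta A (Θ := Θ)), MonoidHom.map_pow, ofMul_pow,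
    ofMul_pullback_detClass_symTheta]

variable (hK : A.KTheta Θ = ⊥)

/-- **`Θ̂ := (φ_Θ⁻¹)^*𝒪(Θ)`** on `Â` (the principal polarisation of `Â` transported from `Θ`). [cite: MumfordAV1970, §8 (p. 77) and §23] -/
def thetaHat : (A.dualOf Θ hΘ).X.left.Modules :=
  (Scheme.Modules.pullback (phiThetaInv A hΘ hK).left).obj (lineBundle Θ.toUnitCocycle)

/-- `Θ̂` is finite locally free. [cite: StacksProject, Tag 01CA] -/
theorem isFiniteLocallyFree_thetaHat : IsFiniteLocallyFree (thetaHat A hΘ hK) :=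
  Θ.toUnitCocycle.isFiniteLocallyFree_lineBundle.pullback _

/-- `Θ̂` has rank one. [cite: StacksProject, Tag 01CA] -/
theorem hasRank_thetaHat : HasRank (thetaHat A hΘ hK) 1 :=
  hasRank_pullback _ Θ.toUnitCocycle.hasRank_lineBundle

/-- **`ofMul (y^*[Θ̂]) = λ(y·φ_Θ⁻¹)`.** [cite: MumfordAV1970, §8 (p. 77)] -/
theorem ofMul_pullback_detClass_thetaHat (y : T ⟶ (A.dualOf Θ hΘ).X) :
    Additive.ofMul (CechPic.pullback y.left (detClass (isFiniteLocallyFree_thetaHat A hΘ hK))) =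
      AbelianVariety.lam Θ (cechCl T.left) (y ≫ phiThetaInv A hΘ hK) := by
  have e := detClass_pullback (phiThetaInv A hΘ hK).left Θ.toUnitCocycle.isFiniteLocallyFree_lineBundle
  rw [detClass_congr (isFiniteLocallyFree_thetaHat A hΘ hK)
      (Θ.toUnitCocycle.isFiniteLocallyFree_lineBundle.pullback (phiThetaInv A hΘ hK).left), e, detClass_lineBundle_toUnitCocycle,
    ← cechPic_pullback_comp₃, ← Over.comp_left, ofMul_pullback_cechClass]

/-- **The `Â`-twist `Θ̂^{⊗s} ⊗ [−1]^*Θ̂^{⊗(s+1)}`** (`dualTwist`). [cite: Markman2025SecantWeil, §9.3 Lemma 9.3.5 (p. 71)] -/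
def dualTwist (s : ℕ) : (A.dualOf Θ hΘ).X.left.Modules :=
  tensorObj (tensorPow (thetaHat A hΘ hK) s)
    ((Scheme.Modules.pullback (-𝟙 (A.dualOf Θ hΘ)).hom.hom.hom.left).obj (tensorPow (thetaHat A hΘ hK) (s + 1)))

/-- `dualTwist s` is finite locally free. [cite: StacksProject, Tag 01CA] -/
theorem isFiniteLocallyFree_dualTwist (s : ℕ) : IsFiniteLocallyFree (dualTwist A hΘ hK s) :=
  isFiniteLocallyFree_tensorObj _ _ (isFiniteLocallyFree_tensorPow (isFiniteLocallyFree_thetaHat A hΘ hK) s)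
    ((isFiniteLocallyFree_tensorPow (isFiniteLocallyFree_thetaHat A hΘ hK) (s + 1)).pullback _)

/-- `dualTwist s` has rank one. [cite: StacksProject, Tag 01CA] -/
theorem hasRank_dualTwist (s : ℕ) : HasRank (dualTwist A hΘ hK s) 1 :=
  hasRank_tensorObj_one (hasRank_tensorPow_one (hasRank_thetaHat A hΘ hK) s)
    (hasRank_pullback _ (hasRank_tensorPow_one (hasRank_thetaHat A hΘ hK) (s + 1)))

/-- **`ofMul (y^*[Θ̂^{⊗s} ⊗ [−1]^*Θ̂^{⊗(s+1)}]) = s • λ(y·φ⁻¹) + (s+1) • λ((y·φ⁻¹)⁻¹)`.** [cite: MumfordAV1970, §6 Corollary 3 and §8] -/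
theorem ofMul_pullback_detClass_dualTwist (s : ℕ) (y : T ⟶ (A.dualOf Θ hΘ).X) :
    Additive.ofMul (CechPic.pullback y.left (detClass (isFiniteLocallyFree_dualTwist A hΘ hK s))) =
      s • AbelianVariety.lam Θ (cechCl T.left) (y ≫ phiThetaInv A hΘ hK) +
        (s + 1) • AbelianVariety.lam Θ (cechCl T.left) (y ≫ phiThetaInv A hΘ hK)⁻¹ := by
  have h₁ := isFiniteLocallyFree_thetaHat A hΘ hK
  have hr := hasRank_thetaHat A hΘ hK
  rw [detClass_tensorObj_of_hasRank_one (hasRank_tensorPow_one hr s) (hasRank_pullback _ (hasRank_tensorPow_one hr (s + 1)))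
      (isFiniteLocallyFree_tensorPow h₁ s) ((isFiniteLocallyFree_tensorPow h₁ (s + 1)).pullback _) (isFiniteLocallyFree_dualTwist A hΘ hK s),
    MonoidHom.map_mul, ofMul_mul, detClass_pullback _ (isFiniteLocallyFree_tensorPow h₁ (s + 1)), ← cechPic_pullback_comp₃,
    detClass_tensorPow hr h₁, detClass_tensorPow hr h₁, MonoidHom.map_pow, MonoidHom.map_pow, ofMul_pow, ofMul_pow,
    ofMul_pullback_detClass_thetaHat, ← Over.comp_left, ofMul_pullback_detClass_thetaHat, comp_neg_one_hom, GrpObj.inv_comp]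

/-- **THE DESCENT TWIST `D′_s := pr_A^*Θ_sym^{⊗s} ⊗ 𝒫^{⊗j} ⊗ pr_Â^*(Θ̂^{⊗s} ⊗ [−1]^*Θ̂^{⊗(s+1)})`** on `A × Â` — the line
bundle by which the twisted span kernel of Markman's `Φ̃` must be multiplied (through `g′`) to descend along `(A×A)×Â → (A/G₁ × A/G₂)×Â`;
Néron–Severi type `(2s, j, 2s+1) ≡ (j, j, j+1) mod n` for `n ∣ 4s + 1`, `n = 2j+1` (print's `D^a`, Lemma 9.3.4/9.3.5, has the
same type). [cite: Markman2025SecantWeil, §9.3 Lemma 9.3.4 and Lemma 9.3.5 (p. 71)] -/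
def descentTwist (s j : ℕ) : (A.X ⊗ (A.dualOf Θ hΘ).X).left.Modules :=
  tensorObj
    (tensorObj ((Scheme.Modules.pullback (fst A.X (A.dualOf Θ hΘ).X).left).obj (tensorPow (symTheta A Θ) s))
      (tensorPow (poincareSheaf A hΘ hK) j))
    ((Scheme.Modules.pullback (snd A.X (A.dualOf Θ hΘ).X).left).obj (dualTwist A hΘ hK s))

/-- `D′_s` is finite locally free. [cite: StacksProject, Tag 01CA] -/
theorem isFiniteLocallyFree_descentTwist (s j : ℕ) : IsFiniteLocallyFree (descentTwist A hΘ hK s j) :=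
  isFiniteLocallyFree_tensorObj _ _
    (isFiniteLocallyFree_tensorObj _ _ ((isFiniteLocallyFree_tensorPow (isFiniteLocallyFree_symTheta A (Θ := Θ)) s).pullback _)
      (isFiniteLocallyFree_tensorPow (isFiniteLocallyFree_poincareSheaf A hΘ hK) j))
    ((isFiniteLocallyFree_dualTwist A hΘ hK s).pullback _)

/-- `D′_s` has rank one. [cite: StacksProject, Tag 01CA] -/
theorem hasRank_descentTwist (s j : ℕ) : HasRank (descentTwist A hΘ hK s j) 1 :=
  hasRank_tensorObj_one
    (hasRank_tensorObj_one (hasRank_pullback _ (hasRank_tensorPow_one (hasRank_symTheta A (Θ := Θ)) s))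
      (hasRank_tensorPow_one (hasRank_poincareSheaf A hΘ hK) j))
    (hasRank_pullback _ (hasRank_dualTwist A hΘ hK s))

/-- **The class of `D′_s` along a `T`-valued point `h = (h₁, h₂)` of `A × Â`:**
`s(λ(h₁) + λ(h₁⁻¹)) + j Λ(h₁, h₂φ⁻¹) + (s λ(h₂φ⁻¹) + (s+1) λ((h₂φ⁻¹)⁻¹))`. [cite: Markman2025SecantWeil, §9.3 Lemma 9.3.4 (p. 71)]
[cite: Lange2023AbelianVarietiesComplex, Lemma 6.1.3] -/
theorem ofMul_pullback_detClass_descentTwist (s j : ℕ) (h : T ⟶ A.X ⊗ (A.dualOf Θ hΘ).X) :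
    Additive.ofMul (CechPic.pullback h.left (detClass (isFiniteLocallyFree_descentTwist A hΘ hK s j))) =
      s • (AbelianVariety.lam Θ (cechCl T.left) (h ≫ fst _ _) + AbelianVariety.lam Θ (cechCl T.left) (h ≫ fst _ _)⁻¹) +
        j • AbelianVariety.Lam Θ (cechCl T.left) (h ≫ fst _ _) (h ≫ snd _ _ ≫ phiThetaInv A hΘ hK) +
        (s • AbelianVariety.lam Θ (cechCl T.left) (h ≫ snd _ _ ≫ phiThetaInv A hΘ hK) +
          (s + 1) • AbelianVariety.lam Θ (cechCl T.left) (h ≫ snd _ _ ≫ phiThetaInv A hΘ hK)⁻¹) := by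
  have hS := isFiniteLocallyFree_symTheta A (Θ := Θ)
  have hSr := hasRank_symTheta A (Θ := Θ)
  have hP := isFiniteLocallyFree_poincareSheaf A hΘ hK
  have hPr := hasRank_poincareSheaf A hΘ hK
  have hD := isFiniteLocallyFree_dualTwist A hΘ hK s
  have hDr := hasRank_dualTwist A hΘ hK s
  have e₁ := detClass_tensorObj_of_hasRank_one
    (hasRank_tensorObj_one (hasRank_pullback (fst A.X (A.dualOf Θ hΘ).X).left (hasRank_tensorPow_one hSr s)) (hasRank_tensorPow_one hPr j))
    (hasRank_pullback (snd A.X (A.dualOf Θ hΘ).X).left hDr)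
    (isFiniteLocallyFree_tensorObj _ _ ((isFiniteLocallyFree_tensorPow hS s).pullback _) (isFiniteLocallyFree_tensorPow hP j))
    (hD.pullback _) (isFiniteLocallyFree_descentTwist A hΘ hK s j)
  have e₂ := detClass_tensorObj_of_hasRank_one (hasRank_pullback (fst A.X (A.dualOf Θ hΘ).X).left (hasRank_tensorPow_one hSr s))
    (hasRank_tensorPow_one hPr j) ((isFiniteLocallyFree_tensorPow hS s).pullback _) (isFiniteLocallyFree_tensorPow hP j)
    (isFiniteLocallyFree_tensorObj _ _ ((isFiniteLocallyFree_tensorPow hS s).pullback _) (isFiniteLocallyFree_tensorPow hP j))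
  have e₃ := detClass_pullback (fst A.X (A.dualOf Θ hΘ).X).left (isFiniteLocallyFree_tensorPow hS s)
  have e₄ := detClass_pullback (snd A.X (A.dualOf Θ hΘ).X).left hD
  rw [e₁, e₂, e₃, e₄, MonoidHom.map_mul, MonoidHom.map_mul, ofMul_mul, ofMul_mul, ← cechPic_pullback_comp₃, ← cechPic_pullback_comp₃,
    ← Over.comp_left, ← Over.comp_left, ofMul_pullback_detClass_tensorPow_symTheta, ofMul_pullback_detClass_dualTwist,
    detClass_tensorPow hPr hP, MonoidHom.map_pow, ofMul_pow, pullback_detClass_poincareSheaf, Category.assoc]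

end Bundles

/-! ### §3 The quotient span source `Z₀ = (A/G₁ × A/G₂) × Â`, `π′`, `κᵢ`, and the descended kernel `𝒩₀` -/

section Descended

variable (hK : A.KTheta Θ = ⊥) {n : ℕ} (hn : n ≠ 0) (G₁ G₂ : Subgroup (A.Points ℂ))
  (hG₁ : G₁ ≤ A.torsionPoints ℂ n) (hG₂ : G₂ ≤ A.torsionPoints ℂ n)

/-- **`π′ := (π₁ × π₂) × 1_Â : (A × A) × Â → (A/G₁ × A/G₂) × Â`.** [cite: MumfordAV1970, §7 Thm. 4 p. 72] -/
def quotientSpanProjection :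
    (A.X ⊗ A.X) ⊗ (A.dualOf Θ hΘ).X ⟶ ((A.torsionQuot hn G₁ hG₁).X ⊗ (A.torsionQuot hn G₂ hG₂).X) ⊗ (A.dualOf Θ hΘ).X :=
  ((A.torsionQuotHom hn G₁ hG₁).hom.hom.hom ⊗ₘ (A.torsionQuotHom hn G₂ hG₂).hom.hom.hom) ▷ (A.dualOf Θ hΘ).X

/-- `π′ ≫ pr₁ = a ≫ π₁`. [cite: MumfordAV1970, §7 Thm. 4 p. 72] -/
@[reassoc]
theorem quotientSpanProjection_comp_pr₁ :
    quotientSpanProjection A hΘ hn G₁ G₂ hG₁ hG₂ ≫ pr₁₂ _ _ _ ≫ fst _ _ =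
      (pr₁₂ A A (A.dualOf Θ hΘ) ≫ fst A.X A.X) ≫ (A.torsionQuotHom hn G₁ hG₁).hom.hom.hom := by
  rw [quotientSpanProjection, ← Category.assoc, whiskerRight_fst, Category.assoc, tensorHom_fst, Category.assoc]

/-- `π′ ≫ pr₂ = b ≫ π₂`. [cite: MumfordAV1970, §7 Thm. 4 p. 72] -/
@[reassoc]
theorem quotientSpanProjection_comp_pr₂ :
    quotientSpanProjection A hΘ hn G₁ G₂ hG₁ hG₂ ≫ pr₁₂ _ _ _ ≫ snd _ _ =
      (pr₁₂ A A (A.dualOf Θ hΘ) ≫ snd A.X A.X) ≫ (A.torsionQuotHom hn G₂ hG₂).hom.hom.hom := by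
  rw [quotientSpanProjection, ← Category.assoc, whiskerRight_fst, Category.assoc, tensorHom_snd, Category.assoc]

/-- `π′ ≫ pr_Â = β`. [cite: MumfordAV1970, §7 Thm. 4 p. 72] -/
@[reassoc]
theorem quotientSpanProjection_comp_snd :
    quotientSpanProjection A hΘ hn G₁ G₂ hG₁ hG₂ ≫ snd _ _ = snd _ _ := by
  rw [quotientSpanProjection, whiskerRight_snd]

/-- **`κ₁ := (pr₁ ≫ r₁, pr_Â) : Z₀ → A × Â`** (`[n] = π₁ ≫ r₁`). [cite: MilneAV2008, I §8 Rem. 8.6 (p. 36)] -/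
def kappa₁ : ((A.torsionQuot hn G₁ hG₁).X ⊗ (A.torsionQuot hn G₂ hG₂).X) ⊗ (A.dualOf Θ hΘ).X ⟶ A.X ⊗ (A.dualOf Θ hΘ).X :=
  lift (pr₁₂ _ _ _ ≫ fst _ _ ≫ (A.zsmulFactor hn G₁ hG₁).hom.hom.hom) (snd _ _)

/-- **`κ₂ := (pr₂ ≫ r₂, pr_Â) : Z₀ → A × Â`.** [cite: MilneAV2008, I §8 Rem. 8.6 (p. 36)] -/
def kappa₂ : ((A.torsionQuot hn G₁ hG₁).X ⊗ (A.torsionQuot hn G₂ hG₂).X) ⊗ (A.dualOf Θ hΘ).X ⟶ A.X ⊗ (A.dualOf Θ hΘ).X :=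
  lift (pr₁₂ _ _ _ ≫ snd _ _ ≫ (A.zsmulFactor hn G₂ hG₂).hom.hom.hom) (snd _ _)

/-- `π′ ≫ κ₁ ≫ pr_A = aⁿ`. [cite: MilneAV2008, I §8 Rem. 8.6 (p. 36)] -/
theorem quotientSpanProjection_comp_kappa₁_fst :
    (quotientSpanProjection A hΘ hn G₁ G₂ hG₁ hG₂ ≫ kappa₁ A hΘ hn G₁ G₂ hG₁ hG₂) ≫ fst _ _ =
      (pr₁₂ A A (A.dualOf Θ hΘ) ≫ fst A.X A.X) ^ n := by
  rw [kappa₁, Category.assoc, lift_fst, quotientSpanProjection_comp_pr₁_assoc, AbelianVariety.comp_torsionQuotHom_comp_zsmulFactor,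
    MonObj.comp_pow]

/-- `π′ ≫ κ₂ ≫ pr_A = bⁿ`. [cite: MilneAV2008, I §8 Rem. 8.6 (p. 36)] -/
theorem quotientSpanProjection_comp_kappa₂_fst :
    (quotientSpanProjection A hΘ hn G₁ G₂ hG₁ hG₂ ≫ kappa₂ A hΘ hn G₁ G₂ hG₁ hG₂) ≫ fst _ _ =
      (pr₁₂ A A (A.dualOf Θ hΘ) ≫ snd A.X A.X) ^ n := by
  rw [kappa₂, Category.assoc, lift_fst, quotientSpanProjection_comp_pr₂_assoc, AbelianVariety.comp_torsionQuotHom_comp_zsmulFactor,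
    MonObj.comp_pow]

/-- `π′ ≫ κᵢ ≫ pr_Â = β`. [cite: MilneAV2008, I §8 Rem. 8.6 (p. 36)] -/
theorem quotientSpanProjection_comp_kappa₁_snd :
    (quotientSpanProjection A hΘ hn G₁ G₂ hG₁ hG₂ ≫ kappa₁ A hΘ hn G₁ G₂ hG₁ hG₂) ≫ snd _ _ = snd _ _ := by
  rw [kappa₁, Category.assoc, lift_snd, quotientSpanProjection_comp_snd]

/-- `π′ ≫ κ₂ ≫ pr_Â = β`. [cite: MilneAV2008, I §8 Rem. 8.6 (p. 36)] -/
theorem quotientSpanProjection_comp_kappa₂_snd :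
    (quotientSpanProjection A hΘ hn G₁ G₂ hG₁ hG₂ ≫ kappa₂ A hΘ hn G₁ G₂ hG₁ hG₂) ≫ snd _ _ = snd _ _ := by
  rw [kappa₂, Category.assoc, lift_snd, quotientSpanProjection_comp_snd]

/-- **THE DESCENDED KERNEL `𝒩₀ := pr₁^*N₁^{⊗m₁} ⊗ pr₂^*N₂^{⊗m₂} ⊗ pr_Â^*(Θ̂^{⊗s} ⊗ [−1]^*Θ̂^{⊗(s+1)}) ⊗ κ₁^*𝒫^{⊗m₁} ⊗ κ₂^*𝒫^{⊗m₂}`**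
on `Z₀ = (A/G₁ × A/G₂) × Â`, `Nᵢ := isogenyNorm πᵢ Θ_sym` (the line bundle with class `[det πᵢ_* Θ_sym]`). [cite: Markman2025SecantWeil, §9.3 Remark 9.3.7 (p. 73)] [cite: MumfordAV1970, §7 Thm. 4 and §23] -/
def markmanDescendedKernel (s m₁ m₂ : ℕ) :
    (((A.torsionQuot hn G₁ hG₁).X ⊗ (A.torsionQuot hn G₂ hG₂).X) ⊗ (A.dualOf Θ hΘ).X).left.Modules :=
  tensorObj (tensorObj (tensorObj (tensorObj
    ((Scheme.Modules.pullback (pr₁₂ (A.torsionQuot hn G₁ hG₁) (A.torsionQuot hn G₂ hG₂) (A.dualOf Θ hΘ) ≫ fst _ _).left).obj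
      (tensorPow (isogenyNorm (A.torsionQuotHom hn G₁ hG₁) (A.isIsogeny_torsionQuotHom hn G₁ hG₁) (symTheta A Θ)
        (isFiniteLocallyFree_symTheta A (Θ := Θ))) m₁))
    ((Scheme.Modules.pullback (pr₁₂ (A.torsionQuot hn G₁ hG₁) (A.torsionQuot hn G₂ hG₂) (A.dualOf Θ hΘ) ≫ snd _ _).left).obj
      (tensorPow (isogenyNorm (A.torsionQuotHom hn G₂ hG₂) (A.isIsogeny_torsionQuotHom hn G₂ hG₂) (symTheta A Θ)
        (isFiniteLocallyFree_symTheta A (Θ := Θ))) m₂)))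
    ((Scheme.Modules.pullback (snd ((A.torsionQuot hn G₁ hG₁).X ⊗ (A.torsionQuot hn G₂ hG₂).X) (A.dualOf Θ hΘ).X).left).obj
      (dualTwist A hΘ hK s)))
    ((Scheme.Modules.pullback (kappa₁ A hΘ hn G₁ G₂ hG₁ hG₂).left).obj (tensorPow (poincareSheaf A hΘ hK) m₁)))
    ((Scheme.Modules.pullback (kappa₂ A hΘ hn G₁ G₂ hG₁ hG₂).left).obj (tensorPow (poincareSheaf A hΘ hK) m₂))

/-- `𝒩₀` is finite locally free. [cite: StacksProject, Tag 01CA] -/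
theorem isFiniteLocallyFree_markmanDescendedKernel (s m₁ m₂ : ℕ) :
    IsFiniteLocallyFree (markmanDescendedKernel A hΘ hK hn G₁ G₂ hG₁ hG₂ s m₁ m₂) :=
  isFiniteLocallyFree_tensorObj _ _ (isFiniteLocallyFree_tensorObj _ _ (isFiniteLocallyFree_tensorObj _ _
    (isFiniteLocallyFree_tensorObj _ _
      ((isFiniteLocallyFree_tensorPow (isFiniteLocallyFree_isogenyNorm _ _ _ _) m₁).pullback _)
      ((isFiniteLocallyFree_tensorPow (isFiniteLocallyFree_isogenyNorm _ _ _ _) m₂).pullback _))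
    ((isFiniteLocallyFree_dualTwist A hΘ hK s).pullback _))
    ((isFiniteLocallyFree_tensorPow (isFiniteLocallyFree_poincareSheaf A hΘ hK) m₁).pullback _))
    ((isFiniteLocallyFree_tensorPow (isFiniteLocallyFree_poincareSheaf A hΘ hK) m₂).pullback _)

/-- `𝒩₀` has rank one. [cite: StacksProject, Tag 01CA] -/
theorem hasRank_markmanDescendedKernel (s m₁ m₂ : ℕ) : HasRank (markmanDescendedKernel A hΘ hK hn G₁ G₂ hG₁ hG₂ s m₁ m₂) 1 :=
  hasRank_tensorObj_one (hasRank_tensorObj_one (hasRank_tensorObj_one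
    (hasRank_tensorObj_one
      (hasRank_pullback _ (hasRank_tensorPow_one (hasRank_isogenyNorm _ _ _ _) m₁))
      (hasRank_pullback _ (hasRank_tensorPow_one (hasRank_isogenyNorm _ _ _ _) m₂)))
    (hasRank_pullback _ (hasRank_dualTwist A hΘ hK s)))
    (hasRank_pullback _ (hasRank_tensorPow_one (hasRank_poincareSheaf A hΘ hK) m₁)))
    (hasRank_pullback _ (hasRank_tensorPow_one (hasRank_poincareSheaf A hΘ hK) m₂))

end Descended

end Literature.AlgebraicGeometry.AbelianVarieties

end
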